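import Literature.Analysis.FluidPDE.SawtoothClosureMargin
import HarnessLib

/-!
# K3′ `K3NonlinearClosure` (aside, stmt-AnomalousDissipation-20027), line `Localised` — helper: the localised-closure
# WINDOW is open on the whole aside box `γ ∈ [4, 8]` with the pessimistic bulk rate `r = γ² − 2`

Helper for the registered line `Localised` (reshape r2, sha `295adcf4`): its predicate
`ClosureWindow := ∀ γ ∈ [4,8], ∀ ρN ∈ {2,…,7}, max(ρN, 3e^{σ⋆γ})·(γ²+2) < (γ²−2)²` (the hypothesis of the skeleton's
`k1LocalisedInWindow_of_pessimisticRate`, which feeds stub S3 with the rate `r = γ² − 2`) HOLDS — proved here with the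
body spelled out (`closureWindow48`).  This is the one numerical fact that distinguishes the aside's box `[4, 8]` from
the box `[5, 8]` of the landed crux K3loc (`SawtoothCascade.closureMargin58`, window `3e^{σ⋆γ}‖B(γ)‖ < (γ²−3)²`, which
FAILS at `γ = 4`): with the envelope `γ² + 2` and the rate `γ² − 2` the binding corner is `γ = 4`,
`3·e^{1.23928}·18 = 186.5 < 196` (margin 5 %).

Proof (same certificate style as `SawtoothClosureMargin`): `e^{4σ⋆} ≤ 3.454`, `e^{5σ⋆} ≤ 4.709`, `e^{8σ⋆} ≤ 11.93`
(`Real.exp_bound'` at `x = σ⋆γ/2` resp. `/4`, `n = 6`, then squared / to the fourth), the chord bounds of the convex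
`exp` on `[4,5]` and `[5,8]`, and two polynomial inequalities all of whose Taylor coefficients at the left end-point
are positive (`nlinarith`); the `ρN`-branch of the `max` is `7(γ²+2) < (γ²−2)²` (`γ² ≥ 16`).  No definitions, no facts.
-/

-- `Summit.<Summit>.<Problem>`: single-conjunct summit, the duplicate namespace segment is deliberate.
set_option linter.dupNamespace false

noncomputable section

namespace Summit.AnomalousDissipation.AnomalousDissipation.Theorems.SawtoothPulseCascade.K3NonlinearClosureLocalised

open Set Real
open Literature.Analysis.FluidPDE.SawtoothCascade

/-- Numeric: `e^{4σ⋆} = e^{1.23928} ≤ 3.454` (`Real.exp_bound'` at `0.61964 = 1.23928/2`, `n = 6`, squared). -/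
theorem exp_sawSigmaStar_mul_four_le : Real.exp (sawSigmaStar * 4) ≤ 3454 / 1000 := by
  -- adapted from Literature/Analysis/FluidPDE/SawtoothClosureMargin.lean (`exp_sawSigmaStar_mul_eight_le`)
  have h := Real.exp_bound' (x := (15491 / 25000 : ℝ)) (by norm_num) (by norm_num) (n := 6) (by norm_num)
  simp only [Finset.sum_range_succ, Finset.sum_range_zero, Nat.factorial] at h
  norm_num at h
  have h2 : Real.exp (sawSigmaStar * 4) = Real.exp (15491 / 25000 : ℝ) ^ 2 := by
    rw [← Real.exp_nat_mul]; norm_num [sawSigmaStar]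
  rw [h2]
  have hpos : 0 ≤ Real.exp (15491 / 25000 : ℝ) := (Real.exp_pos _).le
  calc Real.exp (15491 / 25000 : ℝ) ^ 2 ≤ _ ^ 2 := pow_le_pow_left₀ hpos h 2
    _ ≤ _ := by norm_num

/-- Numeric: `e^{5σ⋆} = e^{1.5491} ≤ 4.709` (`Real.exp_bound'` at `0.77455 = 1.5491/2`, `n = 6`, squared). -/
theorem exp_sawSigmaStar_mul_five_le' : Real.exp (sawSigmaStar * 5) ≤ 4709 / 1000 := by
  -- adapted from Literature/Analysis/FluidPDE/SawtoothClosureMargin.lean (`exp_sawSigmaStar_mul_five_le`)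
  have h := Real.exp_bound' (x := (15491 / 20000 : ℝ)) (by norm_num) (by norm_num) (n := 6) (by norm_num)
  simp only [Finset.sum_range_succ, Finset.sum_range_zero, Nat.factorial] at h
  norm_num at h
  have h2 : Real.exp (sawSigmaStar * 5) = Real.exp (15491 / 20000 : ℝ) ^ 2 := by
    rw [← Real.exp_nat_mul]; norm_num [sawSigmaStar]
  rw [h2]
  have hpos : 0 ≤ Real.exp (15491 / 20000 : ℝ) := (Real.exp_pos _).le
  calc Real.exp (15491 / 20000 : ℝ) ^ 2 ≤ _ ^ 2 := pow_le_pow_left₀ hpos h 2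
    _ ≤ _ := by norm_num

/-- Numeric: `e^{8σ⋆} = e^{2.47856} ≤ 11.93` (`Real.exp_bound'` at `0.61964 = 2.47856/4`, `n = 6`, fourth power). -/
theorem exp_sawSigmaStar_mul_eight_le' : Real.exp (sawSigmaStar * 8) ≤ 1193 / 100 := by
  -- adapted from Literature/Analysis/FluidPDE/SawtoothClosureMargin.lean (`exp_sawSigmaStar_mul_eight_le`)
  have h := Real.exp_bound' (x := (15491 / 25000 : ℝ)) (by norm_num) (by norm_num) (n := 6) (by norm_num)
  simp only [Finset.sum_range_succ, Finset.sum_range_zero, Nat.factorial] at h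
  norm_num at h
  have h4 : Real.exp (sawSigmaStar * 8) = Real.exp (15491 / 25000 : ℝ) ^ 4 := by
    rw [← Real.exp_nat_mul]; norm_num [sawSigmaStar]
  rw [h4]
  have hpos : 0 ≤ Real.exp (15491 / 25000 : ℝ) := (Real.exp_pos _).le
  calc Real.exp (15491 / 25000 : ℝ) ^ 4 ≤ _ ^ 4 := pow_le_pow_left₀ hpos h 4
    _ ≤ _ := by norm_num

/-- Chord bound on `[4, 5]`: `e^{σ⋆γ} ≤ (5 − γ)·3.454 + (γ − 4)·4.709` (convexity of `exp`). -/
theorem exp_sawSigmaStar_mul_le_chord45 {γ : ℝ} (h4 : 4 ≤ γ) (h5 : γ ≤ 5) :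
    Real.exp (sawSigmaStar * γ) ≤ (5 - γ) * (3454 / 1000) + (γ - 4) * (4709 / 1000) := by
  have ha : 0 ≤ 5 - γ := by linarith
  have hb : 0 ≤ γ - 4 := by linarith
  have hconv := convexOn_exp.2 (mem_univ (sawSigmaStar * 4)) (mem_univ (sawSigmaStar * 5)) ha hb (by ring)
  simp only [smul_eq_mul] at hconv
  have harg : (5 - γ) * (sawSigmaStar * 4) + (γ - 4) * (sawSigmaStar * 5) = sawSigmaStar * γ := by ring
  rw [harg] at hconv
  have e4 := mul_le_mul_of_nonneg_left exp_sawSigmaStar_mul_four_le ha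
  have e5 := mul_le_mul_of_nonneg_left exp_sawSigmaStar_mul_five_le' hb
  linarith

/-- Chord bound on `[5, 8]`: `e^{σ⋆γ} ≤ ((8 − γ)·4.709 + (γ − 5)·11.93)/3` (convexity of `exp`). -/
theorem exp_sawSigmaStar_mul_le_chord58 {γ : ℝ} (h5 : 5 ≤ γ) (h8 : γ ≤ 8) :
    Real.exp (sawSigmaStar * γ) ≤ ((8 - γ) * (4709 / 1000) + (γ - 5) * (1193 / 100)) / 3 := by
  have ha : 0 ≤ (8 - γ) / 3 := by linarith
  have hb : 0 ≤ (γ - 5) / 3 := by linarith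
  have hconv := convexOn_exp.2 (mem_univ (sawSigmaStar * 5)) (mem_univ (sawSigmaStar * 8)) ha hb (by ring)
  simp only [smul_eq_mul] at hconv
  have harg : (8 - γ) / 3 * (sawSigmaStar * 5) + (γ - 5) / 3 * (sawSigmaStar * 8) = sawSigmaStar * γ := by ring
  rw [harg] at hconv
  have e5 := mul_le_mul_of_nonneg_left exp_sawSigmaStar_mul_five_le' ha
  have e8 := mul_le_mul_of_nonneg_left exp_sawSigmaStar_mul_eight_le' hb
  linarith

/-- The exponential branch of the window on the aside box: `3 e^{σ⋆γ} (γ² + 2) < (γ² − 2)²` for `γ ∈ [4, 8]`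
(binding at `γ = 4`: `186.5 < 196`). -/
theorem three_exp_mul_lt {γ : ℝ} (hγ : γ ∈ Icc (4 : ℝ) 8) :
    3 * Real.exp (sawSigmaStar * γ) * (γ ^ 2 + 2) < (γ ^ 2 - 2) ^ 2 := by
  obtain ⟨h4, h8⟩ := hγ
  have hg2 : 0 ≤ γ ^ 2 + 2 := by positivity
  rcases le_total γ 5 with h5 | h5
  · have hch := exp_sawSigmaStar_mul_le_chord45 h4 h5
    have h1 : 3 * Real.exp (sawSigmaStar * γ) * (γ ^ 2 + 2) ≤
        3 * ((5 - γ) * (3454 / 1000) + (γ - 4) * (4709 / 1000)) * (γ ^ 2 + 2) := by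
      have := mul_le_mul_of_nonneg_right (mul_le_mul_of_nonneg_left hch (by norm_num : (0 : ℝ) ≤ 3)) hg2
      linarith
    have ht : 0 ≤ γ - 4 := by linarith
    have hpoly : 3 * ((5 - γ) * (3454 / 1000) + (γ - 4) * (4709 / 1000)) * (γ ^ 2 + 2) < (γ ^ 2 - 2) ^ 2 := by
      nlinarith [mul_nonneg ht ht, mul_nonneg (mul_nonneg ht ht) ht, mul_nonneg (mul_nonneg ht ht) (mul_nonneg ht ht)]
    exact lt_of_le_of_lt h1 hpoly
  · have hch := exp_sawSigmaStar_mul_le_chord58 h5 h8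
    have h1 : 3 * Real.exp (sawSigmaStar * γ) * (γ ^ 2 + 2) ≤
        3 * (((8 - γ) * (4709 / 1000) + (γ - 5) * (1193 / 100)) / 3) * (γ ^ 2 + 2) := by
      have := mul_le_mul_of_nonneg_right (mul_le_mul_of_nonneg_left hch (by norm_num : (0 : ℝ) ≤ 3)) hg2
      linarith
    have ht : 0 ≤ γ - 5 := by linarith
    have hpoly : 3 * (((8 - γ) * (4709 / 1000) + (γ - 5) * (1193 / 100)) / 3) * (γ ^ 2 + 2) < (γ ^ 2 - 2) ^ 2 := by
      nlinarith [mul_nonneg ht ht, mul_nonneg (mul_nonneg ht ht) ht, mul_nonneg (mul_nonneg ht ht) (mul_nonneg ht ht)]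
    exact lt_of_le_of_lt h1 hpoly

/-- **The localised-closure window is open on the aside box** (`ClosureWindow` of the line `Localised`, body spelled
out): for every `γ ∈ [4, 8]` and `ρN ∈ {2, …, 7}`, `max(ρN, 3e^{σ⋆γ})·(γ² + 2) < (γ² − 2)²`, i.e. the pessimistic
bulk rate `r = γ² − 2` is admissible for `k1LocalisedInWindow_of_pessimisticRate`.
[cite: Drazin2002, §8.3 Example 8.3 and Exercise 8.10 (σ⋆)] [cite: BrueDeLellisCMP2023, §2 Question 2.1 (the target)] -/
theorem closureWindow48 :
    ∀ γ ∈ Icc (4 : ℝ) 8, ∀ ρN : ℕ, ρN ∈ Finset.Icc 2 7 →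
      max (ρN : ℝ) (3 * Real.exp (sawSigmaStar * γ)) * (γ ^ 2 + 2) < (γ ^ 2 - 2) ^ 2 := by
  intro γ hγ ρN hρN
  have hρ7 : (ρN : ℝ) ≤ 7 := by exact_mod_cast (Finset.mem_Icc.1 hρN).2
  have hg2 : 0 ≤ γ ^ 2 + 2 := by positivity
  have hsq : 16 ≤ γ ^ 2 := by nlinarith [hγ.1]
  have hrho : (ρN : ℝ) * (γ ^ 2 + 2) < (γ ^ 2 - 2) ^ 2 := by
    calc (ρN : ℝ) * (γ ^ 2 + 2) ≤ 7 * (γ ^ 2 + 2) := mul_le_mul_of_nonneg_right hρ7 hg2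
      _ < (γ ^ 2 - 2) ^ 2 := by nlinarith
  rw [max_mul_of_nonneg _ _ hg2]
  exact max_lt hrho (three_exp_mul_lt hγ)

end Summit.AnomalousDissipation.AnomalousDissipation.Theorems.SawtoothPulseCascade.K3NonlinearClosureLocalised

end
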